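import Summits.QuantumFields.YangMills.Theorems.UnitScaleTiltProp7CovDivProductRules
import HarnessLib

/-!
# Prop 7, route-R E′, (E1-c) brick F4c(ii) — THE RESUMMED TERM UNDER `D*_W`, LIPSCHITZ VERSION: `D*[ĉ(ψ)B − ĉ(ψ′)B′]` = TWO SITE TERMS (kept, for the ρ₃-junction) + κ·Σ|D*ψ||B−B′| + θ·Σ(four-point)

Route `UnitScaleTilt`, crux K1 child «MinimiserStabilityRegPr» (`stmt-QuantumFields-19200`), cell ym3-torus, width seat px15 (gen 2); pen «px15 g2: (E1-c) GO-LOCATE» (★p1 g15,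
2026-08-28T20:45:05Z), LOCATE `LOCATE-E1C-DIVLIPSCHITZ-px15g2.md` §6 (F4).  THEOREMS ONLY (0 `def`, 0 `sorry`); `--supports stmt-QuantumFields-19200`, count-neutral.
YM₃ on T³ is a ladder rung (R3), not the Clay problem; nothing here claims the stub, the crux, d = 4 or the mass gap.

WHY.  The contraction's `hN` (✓p667460) is a bound on `D*_W(N(ψ) − N(ψ′))`; the resummed part of `P₂` is the bond field `ĉ(ψ y)(B_ψ μ y)` (F3c ✓p671341, coefficient rows F4b ✓p671886),
so one needs F1 ✓p669426's product rule in LIPSCHITZ form: for two site fields `ψ, ψ′` (values in the ball `‖·‖ ≤ R₀` where the coefficient rows hold) and two bond data `B, B′`,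
  `D*[ĉ(ψ)B − ĉ(ψ′)B′](x) = ĉ(ψ x)(D*(B−B′)(x)) + [ĉ(ψ x) − ĉ(ψ′ x)](D*B′(x)) + Σ_μ{κ-terms} + Σ_μ{four-point terms}`.
The two SITE terms are returned UNESTIMATED (F4c(iii) bounds them with the pinned-cone sizes `2‖ψ(x)‖‖·‖`, `κ‖(ψ−ψ′)(x)‖‖·‖` and the pinned path bound ⧗p672031 — the ρ₃ junction);
the bond sums are bounded here: `κ·Σ_μ‖D*_μψ(x)‖‖(B−B′)_μ(y)‖` (F1's local Lipschitz row) and `θ·Σ_μ(‖D*_μ(ψ−ψ′)(x)‖ + 2‖D*_μψ′(x)‖(‖(ψ−ψ′)(y)‖ + ‖(ψ−ψ′)(x)‖))‖B′_μ(y)‖`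
(the four-point row of `λ ↦ ĉ(λ)`, F4b `norm_coeff_secondDiff_apply_le`: `θ = 2e^{2R₀}`), `y = x − e_μ`.

WHAT IS PROVED (F1's abstract lattice letters `T, U, R, covDstar, divB` of `B9Eq39Adjoint` over `M_n(ℂ)` (L²-operator norm); norm-preserving transports `‖R(U μ x)⁻¹M‖ = ‖M‖`;
a generic coefficient `ĉ` with F1's `hĉ`, `hĉsum`, `hequiv` and the LOCAL rows `hκ`, `hθ` on `‖λ‖ ≤ R₀`): `divB_sub`, `covDstar_sub`, `norm_transport_site_eq` (`‖ψ x + D*_μψ x‖ = ‖ψ y‖`),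
`divB_coeffDiff_eq` (the exact four-term identity), ★★★ `norm_divB_coeffDiff_le` (the displayed bound).  HONEST SCOPE.  Algebra + triangle inequalities ([folklore]).

References: T. Bałaban, CMP 99 (1985) 389–434 [Balaban1985BackgroundPropagators] ((3.8) p.392); CMP 98 (1985) 17–51 [Balaban1985Averaging] ((32)–(34) p.22).
-/

set_option autoImplicit false

noncomputable section

open scoped BigOperators Matrix.Norms.L2Operator Matrix
open NormedSpace

namespace Summit.QuantumFields.YangMills.Theorems.Prop7ResumTermDivLipschitz

open Literature.MathematicalPhysics.QuantumFieldTheory.Balaban1983to89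
open Finset
open B9Eq39Adjoint (R R_def R_add R_sub covD covDstar divB)
open Summit.QuantumFields.YangMills.Theorems.Prop7CovDivProductRules (divB_siteCoeff_eq divB_siteCoeff_eq_of_equivariant)

variable {n : Type*} [Fintype n] [DecidableEq n] [Nonempty n]
variable {S : Type*} {ι : Type*} (T : ι → Equiv.Perm S) (U : ι → S → (Matrix n n ℂ)ˣ)

omit [Nonempty n] in
/-- `D*_μ` is additive: `D*_μ(G − G′) = D*_μG − D*_μG′`. [folklore] -/
theorem covDstar_sub (μ : ι) (G G' : S → Matrix n n ℂ) (x : S) :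
    covDstar T U μ (fun y => G y - G' y) x = covDstar T U μ G x - covDstar T U μ G' x := by
  simp only [covDstar, R_sub]
  abel

variable [Fintype ι]

omit [Nonempty n] in
/-- `D*` is additive in the bond datum: `D*(A − A′) = D*A − D*A′`. [folklore] -/
theorem divB_sub (A A' : ι → S → Matrix n n ℂ) (x : S) :
    divB T U (fun μ y => A μ y - A' μ y) x = divB T U A x - divB T U A' x := by
  simp only [divB, ← Finset.sum_sub_distrib]
  exact Finset.sum_congr rfl fun μ _ => covDstar_sub T U μ (A μ) (A' μ) x

omit [Fintype ι] [Nonempty n] in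
/-- The transported neighbour value: `ψ x + D*_μψ(x) = R(U μ y)⁻¹ ψ(y)`, `y = x − e_μ`; hence `‖ψ x + D*_μψ x‖ = ‖ψ y‖` for norm-preserving transports. [folklore] -/
theorem norm_transport_site_eq (hRn : ∀ μ x (M : Matrix n n ℂ), ‖R (U μ x)⁻¹ M‖ = ‖M‖) (μ : ι) (ψ : S → Matrix n n ℂ) (x : S) :
    ‖ψ x + covDstar T U μ ψ x‖ = ‖ψ ((T μ).symm x)‖ := by
  simp only [covDstar, add_sub_cancel, hRn]

omit [Nonempty n] in
/-- **THE FOUR-TERM IDENTITY**: `D*[ĉ(ψ)B − ĉ(ψ′)B′](x) = ĉ(ψ x)(D*(B−B′)x) + Σ_μ[κ-brackets] + ([ĉ(ψ x) − ĉ(ψ′ x)](D*B′ x) + Σ_μ[four-point brackets])`. [folklore] -/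
theorem divB_coeffDiff_eq (ĉ : Matrix n n ℂ → Matrix n n ℂ → Matrix n n ℂ) (hĉ : ∀ lam Z Z', ĉ lam (Z - Z') = ĉ lam Z - ĉ lam Z')
    (hĉsum : ∀ lam (f : ι → Matrix n n ℂ), ĉ lam (∑ μ, f μ) = ∑ μ, ĉ lam (f μ))
    (hequiv : ∀ μ y lam Z, R (U μ y)⁻¹ (ĉ lam Z) = ĉ (R (U μ y)⁻¹ lam) (R (U μ y)⁻¹ Z))
    (ψ ψ' : S → Matrix n n ℂ) (B B' : ι → S → Matrix n n ℂ) (x : S) :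
    divB T U (fun μ y => ĉ (ψ y) (B μ y) - ĉ (ψ' y) (B' μ y)) x
      = (ĉ (ψ x) (divB T U (fun μ y => B μ y - B' μ y) x)
          + ∑ μ, (ĉ (ψ x + covDstar T U μ ψ x) (R (U μ ((T μ).symm x))⁻¹ (B μ ((T μ).symm x) - B' μ ((T μ).symm x)))
                  - ĉ (ψ x) (R (U μ ((T μ).symm x))⁻¹ (B μ ((T μ).symm x) - B' μ ((T μ).symm x)))))
        + ((ĉ (ψ x) (divB T U B' x) - ĉ (ψ' x) (divB T U B' x))
          + ∑ μ, ((ĉ (ψ x + covDstar T U μ ψ x) (R (U μ ((T μ).symm x))⁻¹ (B' μ ((T μ).symm x)))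
                    - ĉ (ψ x) (R (U μ ((T μ).symm x))⁻¹ (B' μ ((T μ).symm x))))
                  - (ĉ (ψ' x + covDstar T U μ ψ' x) (R (U μ ((T μ).symm x))⁻¹ (B' μ ((T μ).symm x)))
                    - ĉ (ψ' x) (R (U μ ((T μ).symm x))⁻¹ (B' μ ((T μ).symm x)))))) := by
  -- split `ĉ(ψ)B − ĉ(ψ′)B′ = ĉ(ψ)(B − B′) + (ĉ(ψ) − ĉ(ψ′))B′`
  have hsplit : (fun μ y => ĉ (ψ y) (B μ y) - ĉ (ψ' y) (B' μ y))
      = fun μ y => ĉ (ψ y) (B μ y - B' μ y) + (ĉ (ψ y) (B' μ y) - ĉ (ψ' y) (B' μ y)) := by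
    funext μ y; rw [hĉ]; abel
  have hadd : ∀ (A A' : ι → S → Matrix n n ℂ), divB T U (fun μ y => A μ y + A' μ y) x = divB T U A x + divB T U A' x := by
    intro A A'
    simp only [divB, covDstar, R_add, ← Finset.sum_add_distrib]
    exact Finset.sum_congr rfl fun μ _ => by abel
  rw [hsplit, hadd (fun μ y => ĉ (ψ y) (B μ y - B' μ y)) (fun μ y => ĉ (ψ y) (B' μ y) - ĉ (ψ' y) (B' μ y))]
  congr 1
  · exact divB_siteCoeff_eq_of_equivariant T U ĉ hĉ hĉsum hequiv ψ (fun μ y => B μ y - B' μ y) x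
  · -- the difference coefficient `c₂ y Z := ĉ(ψ y)Z − ĉ(ψ′ y)Z` is a site family of additive maps
    rw [divB_siteCoeff_eq T U (fun y Z => ĉ (ψ y) Z - ĉ (ψ' y) Z) (fun y Z Z' => by rw [hĉ, hĉ]; abel)
      (fun y f => by rw [hĉsum, hĉsum, Finset.sum_sub_distrib]) B' x]
    congr 1
    refine Finset.sum_congr rfl fun μ _ => ?_
    rw [R_sub, hequiv, hequiv]
    have e1 : R (U μ ((T μ).symm x))⁻¹ (ψ ((T μ).symm x)) = ψ x + covDstar T U μ ψ x := by
      simp only [covDstar, add_sub_cancel]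
    have e2 : R (U μ ((T μ).symm x))⁻¹ (ψ' ((T μ).symm x)) = ψ' x + covDstar T U μ ψ' x := by
      simp only [covDstar, add_sub_cancel]
    rw [e1, e2]
    abel

omit [Nonempty n] in
/-- ★★★ **THE RESUMMED TERM UNDER `D*`, LIPSCHITZ VERSION.**  With norm-preserving transports, site fields valued in the ball `‖·‖ ≤ R₀`, and a coefficient `ĉ` obeying F1's
algebraic hypotheses and the LOCAL rows `hκ` (Lipschitz) and `hθ` (four-point) on that ball:
`‖D*[ĉ(ψ)B − ĉ(ψ′)B′](x)‖ ≤ ‖ĉ(ψ x)(D*(B−B′)x)‖ + ‖ĉ(ψ x)(D*B′x) − ĉ(ψ′ x)(D*B′x)‖ + κ·Σ_μ‖D*_μψ x‖‖(B−B′)_μ y‖ + θ·Σ_μ(‖D*_μψ x − D*_μψ′ x‖ + 2‖D*_μψ′ x‖(‖ψ y − ψ′ y‖ + ‖ψ x − ψ′ x‖))‖B′_μ y‖`.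
[cite: Balaban1985BackgroundPropagators, (3.8) p.392] [cite: Balaban1985Averaging, (32)-(34) p.22] -/
theorem norm_divB_coeffDiff_le (hRn : ∀ μ x (M : Matrix n n ℂ), ‖R (U μ x)⁻¹ M‖ = ‖M‖)
    (ĉ : Matrix n n ℂ → Matrix n n ℂ → Matrix n n ℂ) (hĉ : ∀ lam Z Z', ĉ lam (Z - Z') = ĉ lam Z - ĉ lam Z')
    (hĉsum : ∀ lam (f : ι → Matrix n n ℂ), ĉ lam (∑ μ, f μ) = ∑ μ, ĉ lam (f μ))
    (hequiv : ∀ μ y lam Z, R (U μ y)⁻¹ (ĉ lam Z) = ĉ (R (U μ y)⁻¹ lam) (R (U μ y)⁻¹ Z))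
    {R₀ κ θ : ℝ} (hκ : ∀ lam lam' Z, ‖lam‖ ≤ R₀ → ‖lam'‖ ≤ R₀ → ‖ĉ lam Z - ĉ lam' Z‖ ≤ κ * ‖lam - lam'‖ * ‖Z‖)
    (hθ : ∀ a b a' b' Z, ‖a‖ ≤ R₀ → ‖b‖ ≤ R₀ → ‖a'‖ ≤ R₀ → ‖b'‖ ≤ R₀ →
      ‖(ĉ a Z - ĉ b Z) - (ĉ a' Z - ĉ b' Z)‖ ≤ θ * (‖(a - b) - (a' - b')‖ + 2 * ‖a' - b'‖ * (‖a - a'‖ + ‖b - b'‖)) * ‖Z‖)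
    (ψ ψ' : S → Matrix n n ℂ) (hψ : ∀ y, ‖ψ y‖ ≤ R₀) (hψ' : ∀ y, ‖ψ' y‖ ≤ R₀) (B B' : ι → S → Matrix n n ℂ) (x : S) :
    ‖divB T U (fun μ y => ĉ (ψ y) (B μ y) - ĉ (ψ' y) (B' μ y)) x‖
      ≤ ‖ĉ (ψ x) (divB T U (fun μ y => B μ y - B' μ y) x)‖ + ‖ĉ (ψ x) (divB T U B' x) - ĉ (ψ' x) (divB T U B' x)‖
        + κ * ∑ μ, ‖covDstar T U μ ψ x‖ * ‖B μ ((T μ).symm x) - B' μ ((T μ).symm x)‖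
        + θ * ∑ μ, (‖covDstar T U μ ψ x - covDstar T U μ ψ' x‖
              + 2 * ‖covDstar T U μ ψ' x‖ * (‖ψ ((T μ).symm x) - ψ' ((T μ).symm x)‖ + ‖ψ x - ψ' x‖)) * ‖B' μ ((T μ).symm x)‖ := by
  rw [divB_coeffDiff_eq T U ĉ hĉ hĉsum hequiv ψ ψ' B B' x]
  have hty : ∀ μ, ‖ψ x + covDstar T U μ ψ x‖ ≤ R₀ := fun μ => by rw [norm_transport_site_eq T U hRn]; exact hψ _
  have hty' : ∀ μ, ‖ψ' x + covDstar T U μ ψ' x‖ ≤ R₀ := fun μ => by rw [norm_transport_site_eq T U hRn]; exact hψ' _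
  -- the κ-sum
  have hK : ‖∑ μ, (ĉ (ψ x + covDstar T U μ ψ x) (R (U μ ((T μ).symm x))⁻¹ (B μ ((T μ).symm x) - B' μ ((T μ).symm x)))
        - ĉ (ψ x) (R (U μ ((T μ).symm x))⁻¹ (B μ ((T μ).symm x) - B' μ ((T μ).symm x))))‖
      ≤ κ * ∑ μ, ‖covDstar T U μ ψ x‖ * ‖B μ ((T μ).symm x) - B' μ ((T μ).symm x)‖ := by
    rw [Finset.mul_sum]
    refine (norm_sum_le _ _).trans (Finset.sum_le_sum fun μ _ => ?_)
    have h := hκ (ψ x + covDstar T U μ ψ x) (ψ x) (R (U μ ((T μ).symm x))⁻¹ (B μ ((T μ).symm x) - B' μ ((T μ).symm x))) (hty μ) (hψ x)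
    rw [add_sub_cancel_left, hRn] at h
    calc _ ≤ κ * ‖covDstar T U μ ψ x‖ * ‖B μ ((T μ).symm x) - B' μ ((T μ).symm x)‖ := h
      _ = κ * (‖covDstar T U μ ψ x‖ * ‖B μ ((T μ).symm x) - B' μ ((T μ).symm x)‖) := by ring
  -- the θ-sum
  have hΘ : ‖∑ μ, ((ĉ (ψ x + covDstar T U μ ψ x) (R (U μ ((T μ).symm x))⁻¹ (B' μ ((T μ).symm x)))
          - ĉ (ψ x) (R (U μ ((T μ).symm x))⁻¹ (B' μ ((T μ).symm x))))
        - (ĉ (ψ' x + covDstar T U μ ψ' x) (R (U μ ((T μ).symm x))⁻¹ (B' μ ((T μ).symm x)))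
          - ĉ (ψ' x) (R (U μ ((T μ).symm x))⁻¹ (B' μ ((T μ).symm x)))))‖
      ≤ θ * ∑ μ, (‖covDstar T U μ ψ x - covDstar T U μ ψ' x‖
            + 2 * ‖covDstar T U μ ψ' x‖ * (‖ψ ((T μ).symm x) - ψ' ((T μ).symm x)‖ + ‖ψ x - ψ' x‖)) * ‖B' μ ((T μ).symm x)‖ := by
    rw [Finset.mul_sum]
    refine (norm_sum_le _ _).trans (Finset.sum_le_sum fun μ _ => ?_)
    have h := hθ (ψ x + covDstar T U μ ψ x) (ψ x) (ψ' x + covDstar T U μ ψ' x) (ψ' x) (R (U μ ((T μ).symm x))⁻¹ (B' μ ((T μ).symm x)))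
      (hty μ) (hψ x) (hty' μ) (hψ' x)
    rw [add_sub_cancel_left, add_sub_cancel_left, hRn] at h
    have e3 : ‖ψ x + covDstar T U μ ψ x - (ψ' x + covDstar T U μ ψ' x)‖ = ‖ψ ((T μ).symm x) - ψ' ((T μ).symm x)‖ := by
      have : ψ x + covDstar T U μ ψ x - (ψ' x + covDstar T U μ ψ' x) = R (U μ ((T μ).symm x))⁻¹ (ψ ((T μ).symm x) - ψ' ((T μ).symm x)) := by
        simp only [covDstar, R_sub]; abel
      rw [this, hRn]
    rw [e3] at h
    calc _ ≤ _ := h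
      _ = θ * ((‖covDstar T U μ ψ x - covDstar T U μ ψ' x‖
            + 2 * ‖covDstar T U μ ψ' x‖ * (‖ψ ((T μ).symm x) - ψ' ((T μ).symm x)‖ + ‖ψ x - ψ' x‖)) * ‖B' μ ((T μ).symm x)‖) := by ring
  calc _ ≤ (‖ĉ (ψ x) (divB T U (fun μ y => B μ y - B' μ y) x)‖
          + ‖∑ μ, (ĉ (ψ x + covDstar T U μ ψ x) (R (U μ ((T μ).symm x))⁻¹ (B μ ((T μ).symm x) - B' μ ((T μ).symm x)))
              - ĉ (ψ x) (R (U μ ((T μ).symm x))⁻¹ (B μ ((T μ).symm x) - B' μ ((T μ).symm x))))‖)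
        + (‖ĉ (ψ x) (divB T U B' x) - ĉ (ψ' x) (divB T U B' x)‖
          + ‖∑ μ, ((ĉ (ψ x + covDstar T U μ ψ x) (R (U μ ((T μ).symm x))⁻¹ (B' μ ((T μ).symm x)))
                - ĉ (ψ x) (R (U μ ((T μ).symm x))⁻¹ (B' μ ((T μ).symm x))))
              - (ĉ (ψ' x + covDstar T U μ ψ' x) (R (U μ ((T μ).symm x))⁻¹ (B' μ ((T μ).symm x)))
                - ĉ (ψ' x) (R (U μ ((T μ).symm x))⁻¹ (B' μ ((T μ).symm x)))))‖) :=
        (norm_add_le _ _).trans (add_le_add (norm_add_le _ _) (norm_add_le _ _))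
    _ ≤ _ := by linarith [hK, hΘ]

end Summit.QuantumFields.YangMills.Theorems.Prop7ResumTermDivLipschitz

end
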